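import Summits.BirchSwinnertonDyer.BirchSwinnertonDyer.Theorems.GenusKolyvaginAtTwoGenusPrimitiveSupplyAtTwoGenusIdentity
import Summits.BirchSwinnertonDyer.BirchSwinnertonDyer.Theorems.GenusKolyvaginAtTwoPowDvdShaCardAtTwoRTKolyvaginMinima
import Summits.BirchSwinnertonDyer.BirchSwinnertonDyer.Theorems.KolyvaginRoadThreeLevelData
import Summits.BirchSwinnertonDyer.BirchSwinnertonDyer.Theorems.CMKolyvaginAtInertTwoNonSquareConditionsAtTwo
import Summits.BirchSwinnertonDyer.Rank1Residual.Partition.MainConjecturesCMInert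
import Literature.NumberTheory.EllipticCurves.RingClassFieldTwoTorsionProofs
import Literature.NumberTheory.EllipticCurves.HeegnerTraceRelationProofs
import Literature.NumberTheory.EllipticCurves.RingClassGalOverCardinality
import Literature.NumberTheory.EllipticCurves.HeegnerPointsOfConductorRationalityProofs
import Literature.NumberTheory.EllipticCurves.RingClassGalOverCyclicProofs
import Literature.NumberTheory.EllipticCurves.HeegnerHypothesisKroneckerProofs
import Literature.NumberTheory.EllipticCurves.ModularityVersionApProofs
import HarnessLib

/-!
# Crux `CMKolyvaginConjectureAtInertTwo` (stmt-BirchSwinnertonDyer-24648), line `birth` (KC_birth, skeleton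
# `f3c3ea09…`), open stub `stub_positiveDepth`: REDUCTION TO ONE CM-INERT KOLYVAGIN PRIME AND ITS GENUS POINT

Route `CMKolyvaginAtInertTwo` (cell `pub/bsd-eis`, seat `leafhand-bsd-cmkolyvaginatinert-1` g0); helper (`--supports
stmt-BirchSwinnertonDyer-24648`). THEOREMS ONLY (no definition, no named fact, no `sorry`); closes nothing.

WHAT. The birth skeleton of crux 24648 splits Kolyvagin's conjecture at `p = 2` on the habitat H₂ by the
`2`-divisibility of `y_K = P(1)` in `E(K[1])`: `stub_levelOne` (landed, p605855) and `stub_positiveDepth` — the case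
`y_K ∈ 2E(K[1])`, asking for a square-free product `n` of Zhang–Kolyvagin primes at `2` inert in `F` with
`P(n) ∉ 2E(K[n])`. This file records what the tree forces on a witness and reduces the stub to ONE genus point:

* §1 — in positive depth the level `n = 1` is DEAD (every conductor-`1` datum has the same `P(1)`, tree
  `GenusExact.RelaxedCount.derivedPoint_eq_of_conductor_one`): a witness has `1 < n` and a CM-inert Kolyvagin prime factor.
* §2 — data EXIST at every square-free product of Zhang–Kolyvagin primes on the frame (tree constructor
  `nonempty_kolyvaginHeegnerData_of_grossCM` + the PROVED CM facts `phi_heegnerPointOfConductor_mem_range_map_ringClassField_holds`,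
  `exists_generator_ringClassGalOver_holds`): the stub's `∃ d` ranges over inhabited types.
* §3 `sum_range_pointGalHom_σ_pow_y_eq_zero` — **at a CM-inert Kolyvagin prime `ℓ` the `G_ℓ`-trace of `y(ℓ)` VANISHES
  in `E(K[ℓ])`**: Gross's Prop. 3.7 (1) (tree THEOREM `HeegnerTrace.finsum_mem_ringClassGalOver_eq_frobeniusTrace_smul`),
  `#G_ℓ = ℓ + 1` (`RingClassField.card_ringClassGalOver_div_eq_succ`), Deuring's `a_ℓ = 0`
  (`Rank1Residual.frobeniusTrace_eq_zero_of_hasCM_of_cmInert`).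
* §4 — hence the GenusKoly dictionary (`GenusKoly.exists_four_zsmul_of_exists_two_zsmul_eq_derivedPoint`) loses its
  trace term: **`P(ℓ) ∈ 2E(K[ℓ]) ⟹ Σ_{s ∈ S} s(Y_χ) ∈ 4E(K[ℓ])`**, `Y_χ = Σ_{i ≤ ℓ} (−1)^i σ_ℓ^i y(ℓ)` (no torsion
  hypothesis); and on H₂ (`E(K[ℓ])[2] = 0`, tree `twoTorsion_eq_zero_ringClassField_of_cmInert_two_of_heegner`) the
  EQUIVALENCE `two_dvd_derivedPoint_iff_four_dvd_genusPoint`.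
* §6 **`two_dvd_derivedPoint_iff_two_dvd_halfTrace`** — the MOD-2 FORM, no torsion hypothesis: with
  `A = Σ_{k < (ℓ+1)/2} σ_ℓ^{2k} y(ℓ)` (norm of `y(ℓ)` to the quadratic layer of `K[ℓ]/K[1]` fixed by `σ_ℓ²`),
  `σ_ℓ A = −A` and **`P(ℓ) ∈ 2E(K[ℓ]) ⟺ Σ_{s ∈ S} s(A) ∈ 2E(K[ℓ])`** (GenusKoly odd-part dictionary + §3).
* §5 **`stub_positiveDepth_of_genusPoint`** — the registered signature of `stub_positiveDepth` VERBATIM from: «on every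
  positive-depth H₂ frame some CM-inert Zhang–Kolyvagin prime `ℓ` at `2` carries a datum of conductor `ℓ` whose genus
  point `Σ_{s ∈ S} s(Y_χ)` is not `4`-divisible in `E(K[ℓ])`» (witness `n = ℓ`).

HONEST FRAMING: a composition of tree theorems (routes GenusKolyvaginAtTwo / KolyvaginRoadThree / Gross 1991
typers); the mathematics of `stub_positiveDepth` is untouched: at prime level it IS the `2`-indivisibility of one
genus trace point in the CM-inert Kolyvagin family — Kolyvagin's non-vanishing at `2`, no printed source
(Kolyvagin 1991 / W. Zhang 2014: `p` odd, non-CM). No item is closed; BSD is proved for no curve.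

References: [cite: GrossLMS1991, §3 (3.5), Prop. 3.7 (1); §4 (4.1)] [cite: WZhang2014, §3.7, Notations (xii)]
[cite: Lang1987, Ch. 13 §4 Thm. 12 (Deuring, a_p = 0 at inert p)].
-/

set_option linter.dupNamespace false -- `Summit.BirchSwinnertonDyer.BirchSwinnertonDyer.Theorems.…` (summit = sub)
set_option autoImplicit false

noncomputable section

open scoped Classical

namespace Summit.BirchSwinnertonDyer.BirchSwinnertonDyer.Theorems.CMKolyvaginConjecturePositiveDepth

open Finset WeierstrassCurve NumberField
open Literature.NumberTheory.EllipticCurves Literature.NumberTheory.EllipticCurves.ModularForms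
open Literature.NumberTheory.EllipticCurves.Rank1Residual
open Summit.BirchSwinnertonDyer.BirchSwinnertonDyer.Theorems

variable {K : Type} [Field K] [NumberField K]

/-! ## §1 Positive depth kills the level `n = 1` -/

/-- **In positive depth a `2`-primitive witness has conductor `n > 1`.** If `y_K = d₁.derivedPoint ∈ 2E(K[1])`
and a datum `d` of square-free conductor `n` has `P(n) ∉ 2E(K[n])`, then `1 < n`: for `n = 1` every datum has
the same derived point as `d₁` (`GenusExact.RelaxedCount.derivedPoint_eq_of_conductor_one`).
[cite: GrossLMS1991, §4 (P_1 = Tr y_1 = y_K)] -/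
theorem one_lt_of_primitive_of_two_dvd_one (W : WeierstrassCurve ℚ) [W.IsElliptic] {N : ℕ} [NeZero N]
    {Dt : ModularParametrizationData W N} {β : ℤ} {ι : K →+* ℂ}
    (d₁ : KolyvaginHeegnerData Dt β ι 1)
    (h2 : ∃ Q : (W.baseChange (ringClassField K ι 1)).toAffine.Point, (2 : ℤ) • Q = d₁.derivedPoint)
    {n : ℕ} (hn : Squarefree n) (d : KolyvaginHeegnerData Dt β ι n)
    (hprim : ¬ ∃ Q : (W.baseChange (ringClassField K ι n)).toAffine.Point, (2 : ℤ) • Q = d.derivedPoint) :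
    1 < n := by
  have hn0 : n ≠ 0 := hn.ne_zero
  by_contra hle
  obtain rfl : n = 1 := by omega
  exact hprim (by rw [GenusExact.RelaxedCount.derivedPoint_eq_of_conductor_one W d₁ d]; exact h2)

/-- **In positive depth a witness level has a CM-inert Kolyvagin prime factor** (the stub's clause on
`n.primeFactors` is then non-vacuous). [cite: WZhang2014, Notations (xii)] -/
theorem exists_primeFactor_of_primitive_of_two_dvd_one (W : WeierstrassCurve ℚ) [W.IsElliptic]
    [W.IsGloballyMinimal] {N : ℕ} [NeZero N]
    {Dt : ModularParametrizationData W N} {β : ℤ} {ι : K →+* ℂ}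
    (d₁ : KolyvaginHeegnerData Dt β ι 1)
    (h2 : ∃ Q : (W.baseChange (ringClassField K ι 1)).toAffine.Point, (2 : ℤ) • Q = d₁.derivedPoint)
    {n : ℕ} (hn : Squarefree n) (d : KolyvaginHeegnerData Dt β ι n)
    (hKol : ∀ ℓ ∈ n.primeFactors, Zhang2014.IsKolyvaginPrime N W K 2 ℓ ∧ CMInert W ℓ)
    (hprim : ¬ ∃ Q : (W.baseChange (ringClassField K ι n)).toAffine.Point, (2 : ℤ) • Q = d.derivedPoint) :
    ∃ ℓ ∈ n.primeFactors, Zhang2014.IsKolyvaginPrime N W K 2 ℓ ∧ CMInert W ℓ := by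
  obtain ⟨ℓ, hℓ⟩ := Nat.nonempty_primeFactors.mpr (one_lt_of_primitive_of_two_dvd_one W d₁ h2 hn d hprim)
  exact ⟨ℓ, hℓ, hKol ℓ hℓ⟩

/-! ## §2 Data exist at every square-free product of Kolyvagin primes -/

/-- **Kolyvagin–Heegner data exist at every Kolyvagin conductor of the frame.** For `E/ℚ` elliptic, `K` imaginary
quadratic and Heegner for `N`, a frame `(Dt, β, ι)` carrying a conductor-`1` datum `d₁` (so `4N ∣ β² − d_K`), and a
square-free `n` all of whose prime factors are Zhang–Kolyvagin primes (inert in `K` by definition):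
`KolyvaginHeegnerData Dt β ι n` is inhabited — the tree constructor `nonempty_kolyvaginHeegnerData_of_grossCM` with
both CM inputs PROVED (`phi_heegnerPointOfConductor_mem_range_map_ringClassField_holds`,
`exists_generator_ringClassGalOver_holds`). [cite: GrossLMS1991, §3 (pp. 238–239), §4 (4.1)] -/
theorem nonempty_kolyvaginHeegnerData_of_kolyvaginPrimes (W : WeierstrassCurve ℚ) [W.IsElliptic]
    [W.IsGloballyMinimal] {N : ℕ} [NeZero N] (hK : IsImaginaryQuadratic K) (hH : SatisfiesHeegnerHypothesis N K)
    (Dt : ModularParametrizationData W N) {β : ℤ} (ι : K →+* ℂ) (d₁ : KolyvaginHeegnerData Dt β ι 1)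
    {p n : ℕ} (hn : Squarefree n) (hKol : ∀ ℓ ∈ n.primeFactors, Zhang2014.IsKolyvaginPrime N W K p ℓ) :
    Nonempty (KolyvaginHeegnerData Dt β ι n) :=
  nonempty_kolyvaginHeegnerData_of_grossCM
    (phi_heegnerPointOfConductor_mem_range_map_ringClassField_holds N W K)
    exists_generator_ringClassGalOver_holds hK hH Dt β ι d₁.dvd_sq_sub hn
    (fun q hq ↦ (hKol q hq).2.2.2.2.1)

/-! ## §3 At a CM-inert Kolyvagin prime the `G_ℓ`-trace of `y(ℓ)` vanishes -/

/-- `Σᶠ` over the cyclic group `⟨x⟩` of order `k` is the sum over the powers `x^0, …, x^{k−1}`. [folklore] -/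
private theorem finsum_mem_zpowers_eq_sum_range {G : Type*} [Group G] {M : Type*} [AddCommMonoid M]
    (x : G) {k : ℕ} (hk : orderOf x = k) (hk0 : k ≠ 0) (f : G → M) :
    ∑ᶠ g ∈ (Subgroup.zpowers x : Set G), f g = ∑ i ∈ Finset.range k, f (x ^ i) := by
  classical
  have hfin : IsOfFinOrder x := orderOf_pos_iff.mp (by omega)
  have hset : (Subgroup.zpowers x : Set G) = ↑((Finset.range k).image (x ^ ·)) := by
    ext g
    rw [SetLike.mem_coe, hfin.mem_zpowers_iff_mem_range_orderOf, hk, Finset.mem_coe]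
  rw [hset, finsum_mem_coe_finset, Finset.sum_image]
  intro i hi j hj hij
  exact pow_injOn_Iio_orderOf (Set.mem_Iio.mpr (hk ▸ Finset.mem_range.mp hi))
    (Set.mem_Iio.mpr (hk ▸ Finset.mem_range.mp hj)) hij

/-- `d_K < −4` for an imaginary quadratic field of odd discriminant `≠ −3` (`|d_K| > 2`, Minkowski). [folklore] -/
private theorem discr_lt_neg_four (hK : IsImaginaryQuadratic K) (hodd : Odd (NumberField.discr K))
    (h3 : NumberField.discr K ≠ -3) : NumberField.discr K < -4 := by
  have hgt : 2 < |NumberField.discr K| := NumberField.abs_discr_gt_two (by rw [hK.1]; exact one_lt_two)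
  have hneg : NumberField.discr K < 0 := hK.discr_neg
  rw [abs_of_neg hneg] at hgt
  obtain ⟨r, hr⟩ := hodd
  omega

/-- **The generator `σ_ℓ` of a prime-conductor datum has order `ℓ + 1`** (`G_ℓ = Gal(K[ℓ]/K[1])` is cyclic of
order `ℓ + 1` for `ℓ` inert in `K`, `d_K < −4`; tree `RingClassField.card_ringClassGalOver_div_eq_succ`).
[cite: GrossLMS1991, §3 (p. 239: G_ℓ ≃ F_λ^×/F_ℓ^× of order ℓ + 1)] -/
theorem orderOf_σ_eq_succ_of_prime (W : WeierstrassCurve ℚ) {N : ℕ} [NeZero N]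
    (hK : IsImaginaryQuadratic K) (hodd : Odd (NumberField.discr K)) (h3 : NumberField.discr K ≠ -3)
    {Dt : ModularParametrizationData W N} {β : ℤ} {ι : K →+* ℂ} {ℓ : ℕ} (hℓ : ℓ.Prime)
    (hinert : (Ideal.span {(ℓ : 𝓞 K)}).IsPrime) (d : KolyvaginHeegnerData Dt β ι ℓ) :
    orderOf (d.σ ℓ) = ℓ + 1 := by
  have hℓℓ : ℓ ∈ ℓ.primeFactors := Nat.mem_primeFactors.mpr ⟨hℓ, dvd_rfl, hℓ.ne_zero⟩
  have hz := d.zpowers_σ ℓ hℓℓ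
  rw [← Nat.card_zpowers, hz]
  refine RingClassField.card_ringClassGalOver_div_eq_succ hK ι hℓ hinert dvd_rfl ?_ hℓ.ne_zero
    (Or.inr (discr_lt_neg_four hK hodd h3))
  rw [Nat.div_self hℓ.pos]
  exact hℓ.not_dvd_one

/-- **At a CM-inert Kolyvagin prime the `G_ℓ`-trace of `y(ℓ)` vanishes**: for `W/ℚ` globally minimal with CM,
`K` imaginary quadratic with odd `d_K ≠ −3` and Heegner for `N_E`, a datum `d` of prime conductor `ℓ`, where
`ℓ` is a Zhang–Kolyvagin prime at `2` (`ℓ ∤ N_E`, `ℓ` odd, inert in `K`) inert in `F` (`CMInert W ℓ`):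
`Σ_{i ≤ ℓ} σ_ℓ^i y(ℓ) = 0` in `E(K[ℓ])`. Gross's Prop. 3.7 (1) `Tr_ℓ y_ℓ = a_ℓ y_1` (tree THEOREM
`HeegnerTrace.finsum_mem_ringClassGalOver_eq_frobeniusTrace_smul`) with Deuring's `a_ℓ = 0`
(`Rank1Residual.frobeniusTrace_eq_zero_of_hasCM_of_cmInert`), the sum over `G_ℓ = ⟨σ_ℓ⟩` written over the
`ℓ + 1` powers of `σ_ℓ`. [cite: GrossLMS1991, §3 Prop. 3.7 (1)] [cite: Lang1987, Ch. 13 §4 Thm. 12] -/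
theorem sum_range_pointGalHom_σ_pow_y_eq_zero (W : WeierstrassCurve ℚ) [W.IsElliptic] [W.IsGloballyMinimal]
    [NeZero (W.conductorNorm ℤ)] (hCM : W.HasCM) (hK : IsImaginaryQuadratic K)
    (hodd : Odd (NumberField.discr K)) (h3 : NumberField.discr K ≠ -3)
    (hH : SatisfiesHeegnerHypothesis (W.conductorNorm ℤ) K)
    {Dt : ModularParametrizationData W (W.conductorNorm ℤ)} {β : ℤ} {ι : K →+* ℂ} {ℓ : ℕ}
    (hℓK : Zhang2014.IsKolyvaginPrime (W.conductorNorm ℤ) W K 2 ℓ) (hℓF : CMInert W ℓ)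
    (d : KolyvaginHeegnerData Dt β ι ℓ) :
    ∑ i ∈ range (ℓ + 1), pointGalHom W (ringClassField K ι ℓ) (d.σ ℓ ^ i) d.y = 0 := by
  obtain ⟨hℓ, hℓN, -, hℓ2, hinert, -⟩ := hℓK
  haveI : Fact ℓ.Prime := ⟨hℓ⟩
  have hND : IsCoprime (W.conductorNorm ℤ : ℤ) (NumberField.discr K) := by
    have h := Literature.SatisfiesHeegnerHypothesis.coprime_discr hK.1 hH
    refine Int.isCoprime_iff_gcd_eq_one.mpr ?_
    rw [Int.gcd_eq_natAbs, Int.natAbs_natCast]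
    exact h
  -- Gross's Prop. 3.7 (1) at the pair `(ℓ, 1)`, read in `E(ℂ)`
  have htr := HeegnerTrace.finsum_mem_ringClassGalOver_eq_frobeniusTrace_smul hK ι Dt hND d.dvd_sq_sub hℓ
    hinert hℓN hℓ.not_dvd_one one_ne_zero (Nat.coprime_one_right _)
    (Or.inr (discr_lt_neg_four hK hodd h3)) (mul_one ℓ) d.map_y
  -- Deuring: `a_ℓ = 0`
  have hgood : W.HasGoodReductionAtPrime ℓ :=
    not_not.mp (mt (W.dvd_conductorNorm_iff_not_hasGoodReductionAtPrime ℓ).mpr hℓN)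
  have ha : W.frobeniusTrace ℓ = 0 :=
    Summit.BirchSwinnertonDyer.Rank1Residual.frobeniusTrace_eq_zero_of_hasCM_of_cmInert hCM hℓ2 hgood hℓF
  rw [ha, zero_zsmul] at htr
  -- the `Σᶠ` over `G_ℓ = ⟨σ_ℓ⟩` is the sum over the `ℓ + 1` powers of `σ_ℓ`
  have hℓℓ : ℓ ∈ ℓ.primeFactors := Nat.mem_primeFactors.mpr ⟨hℓ, dvd_rfl, hℓ.ne_zero⟩
  have hz : (Subgroup.zpowers (d.σ ℓ) : Set (ringClassField K ι ℓ ≃ₐ[ℚ] ringClassField K ι ℓ)) =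
      (ringClassGalOver ι ℓ 1 : Set (ringClassField K ι ℓ ≃ₐ[ℚ] ringClassField K ι ℓ)) := by
    rw [d.zpowers_σ ℓ hℓℓ, Nat.div_self hℓ.pos]
  rw [← hz, finsum_mem_zpowers_eq_sum_range (d.σ ℓ) (orderOf_σ_eq_succ_of_prime W hK hodd h3 hℓ hinert d)
    (Nat.succ_ne_zero ℓ), ← map_sum] at htr
  exact WeierstrassCurve.Affine.Point.map_injective (W' := W) (ringClassField K ι ℓ).subtype.toRatAlgHom
    (htr.trans (map_zero _).symm)

/-! ## §4 The genus dictionary on H₂: the trace term is gone -/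

/-- **`P(ℓ) ∈ 2E(K[ℓ]) ⟹ Σ_{s ∈ S} s(Y_χ) ∈ 4E(K[ℓ])` at a CM-inert Kolyvagin prime** (same standing hypotheses):
the GenusKoly dictionary `2·P(ℓ) = Σ_s s(Tr y) − Σ_s s(Y_χ) + 4·Z`
(`GenusKoly.exists_four_zsmul_of_exists_two_zsmul_eq_derivedPoint`) with `Tr y = Σ_{i ≤ ℓ} σ_ℓ^i y(ℓ) = 0` (§3);
`Y_χ = Σ_{i ≤ ℓ} (−1)^i σ_ℓ^i y(ℓ)` is the genus-character sum. No torsion hypothesis.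
[cite: GrossLMS1991, §3 (3.5), Prop. 3.7 (1), §4 (4.1)] -/
theorem exists_four_zsmul_eq_genusPoint_of_two_dvd_derivedPoint (W : WeierstrassCurve ℚ) [W.IsElliptic]
    [W.IsGloballyMinimal] [NeZero (W.conductorNorm ℤ)] (hCM : W.HasCM) (hK : IsImaginaryQuadratic K)
    (hodd : Odd (NumberField.discr K)) (h3 : NumberField.discr K ≠ -3)
    (hH : SatisfiesHeegnerHypothesis (W.conductorNorm ℤ) K)
    {Dt : ModularParametrizationData W (W.conductorNorm ℤ)} {β : ℤ} {ι : K →+* ℂ} {ℓ : ℕ}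
    (hℓK : Zhang2014.IsKolyvaginPrime (W.conductorNorm ℤ) W K 2 ℓ) (hℓF : CMInert W ℓ)
    (d : KolyvaginHeegnerData Dt β ι ℓ)
    (h2 : ∃ Q : (W.baseChange (ringClassField K ι ℓ)).toAffine.Point, (2 : ℤ) • Q = d.derivedPoint) :
    ∃ R : (W.baseChange (ringClassField K ι ℓ)).toAffine.Point, (4 : ℤ) • R =
      ∑ s ∈ d.S, pointGalHom W (ringClassField K ι ℓ) s
        (∑ i ∈ range (ℓ + 1), ((-1 : ℤ) ^ i) • pointGalHom W (ringClassField K ι ℓ) (d.σ ℓ ^ i) d.y) := by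
  obtain ⟨R, hR⟩ := GenusKoly.exists_four_zsmul_of_exists_two_zsmul_eq_derivedPoint
    (pointGalHom W (ringClassField K ι ℓ)) d.σ hℓK.1 d.S d.y h2
  rw [sum_range_pointGalHom_σ_pow_y_eq_zero W hCM hK hodd h3 hH hℓK hℓF d] at hR
  simp only [map_zero, Finset.sum_const_zero, zero_sub] at hR
  exact ⟨-R, by rw [smul_neg, hR, neg_neg]⟩

/-- **`E(K[ℓ])[2] = 0` on H₂ at a CM-inert prime level**: for `W` with CM, `CMInert W 2`, `ρ̄_{W,2}` onto, `K`
imaginary quadratic and Heegner for `N_E`, and a prime `ℓ` inert in `F`: every `P ∈ E(K[ℓ])` with `2P = O` is `O`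
(tree `twoTorsion_eq_zero_ringClassField_of_cmInert_two_of_heegner`; the CM prime `q = |d_F|` divides `N_E`,
`KolyvaginFrobeniusTwo.cmPrime_dvd_conductorNorm_of_cmInert_two`, and `q ≠ ℓ` since `ℓ ∤ d_F`).
[cite: GrossLMS1991, §4 Lemma 4.3 (no K_n-rational p-torsion)] -/
theorem twoTorsion_eq_zero_of_cmInert_prime (W : WeierstrassCurve ℚ) [W.IsElliptic] [W.IsGloballyMinimal]
    (hCM : W.HasCM) (hin : CMInert W 2) (hρ : W.HasSurjectiveModNGaloisRep (2 : ℤ))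
    (hK : IsImaginaryQuadratic K) (ι : K →+* ℂ) (hH : SatisfiesHeegnerHypothesis (W.conductorNorm ℤ) K)
    {ℓ : ℕ} (hℓ : ℓ.Prime) (hℓF : CMInert W ℓ)
    (P : (W.baseChange (ringClassField K ι ℓ)).toAffine.Point) (hP : (2 : ℤ) • P = 0) : P = 0 := by
  obtain ⟨q, hq, hq2, hdF⟩ := KolyvaginFrobeniusTwo.exists_prime_cmFieldDiscr_eq_neg_of_cmInert_two W hin
  have hqN : (cmFieldDiscrOfJ W.j).natAbs ∣ W.conductorNorm ℤ := by
    rw [hdF, Int.natAbs_neg, Int.natAbs_natCast]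
    exact KolyvaginFrobeniusTwo.cmPrime_dvd_conductorNorm_of_cmInert_two W hCM hq hq2 hdF
  have hqℓ : ¬ (cmFieldDiscrOfJ W.j).natAbs ∣ ℓ := by
    rw [hdF, Int.natAbs_neg, Int.natAbs_natCast]
    intro hdvd
    have hql : q = ℓ := (Nat.prime_dvd_prime_iff_eq hq hℓ).mp hdvd
    exact hℓF.1 (by rw [CMRamified, hdF, hql]; exact dvd_neg.mpr dvd_rfl)
  refine twoTorsion_eq_zero_ringClassField_of_cmInert_two_of_heegner W hρ hin hK ι hH hqN hℓ.ne_zero hqℓ P ?_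
  rw [← natCast_zsmul]
  exact_mod_cast hP

/-- **The genus dictionary on H₂, both ways**: at a Zhang–Kolyvagin prime `ℓ` at `2` inert in `F`, for `W` with CM,
`CMInert W 2`, `ρ̄_{W,2}` onto, `K` with odd `d_K ≠ −3` and Heegner for `N_E`, and any datum `d` of conductor `ℓ`:
**`P(ℓ) ∈ 2E(K[ℓ]) ⟺ Σ_{s ∈ S} s(Y_χ) ∈ 4E(K[ℓ])`** (`GenusKoly.exists_two_zsmul_eq_derivedPoint_iff` with the trace
term killed by §3 and `E(K[ℓ])[2] = 0`). So at prime level the open stub IS the `4`-indivisibility of one genus point.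
[cite: GrossLMS1991, §3 (3.5), Prop. 3.7 (1), §4 (4.1), Lemma 4.3] -/
theorem two_dvd_derivedPoint_iff_four_dvd_genusPoint (W : WeierstrassCurve ℚ) [W.IsElliptic]
    [W.IsGloballyMinimal] [NeZero (W.conductorNorm ℤ)] (hCM : W.HasCM) (hin : CMInert W 2)
    (hρ : W.HasSurjectiveModNGaloisRep (2 : ℤ)) (hK : IsImaginaryQuadratic K)
    (hodd : Odd (NumberField.discr K)) (h3 : NumberField.discr K ≠ -3)
    (hH : SatisfiesHeegnerHypothesis (W.conductorNorm ℤ) K)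
    {Dt : ModularParametrizationData W (W.conductorNorm ℤ)} {β : ℤ} {ι : K →+* ℂ} {ℓ : ℕ}
    (hℓK : Zhang2014.IsKolyvaginPrime (W.conductorNorm ℤ) W K 2 ℓ) (hℓF : CMInert W ℓ)
    (d : KolyvaginHeegnerData Dt β ι ℓ) :
    (∃ Q : (W.baseChange (ringClassField K ι ℓ)).toAffine.Point, (2 : ℤ) • Q = d.derivedPoint) ↔
      ∃ R : (W.baseChange (ringClassField K ι ℓ)).toAffine.Point, (4 : ℤ) • R =
        ∑ s ∈ d.S, pointGalHom W (ringClassField K ι ℓ) s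
          (∑ i ∈ range (ℓ + 1), ((-1 : ℤ) ^ i) • pointGalHom W (ringClassField K ι ℓ) (d.σ ℓ ^ i) d.y) := by
  have key := GenusKoly.exists_two_zsmul_eq_derivedPoint_iff (pointGalHom W (ringClassField K ι ℓ)) d.σ hℓK.1
    d.S d.y (twoTorsion_eq_zero_of_cmInert_prime W hCM hin hρ hK ι hH hℓK.1 hℓF)
  rw [sum_range_pointGalHom_σ_pow_y_eq_zero W hCM hK hodd h3 hH hℓK hℓF d] at key
  simp only [map_zero, Finset.sum_const_zero, zero_sub] at key
  rw [KolyvaginHeegnerData.derivedPoint, key]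
  constructor
  · rintro ⟨R, hR⟩
    exact ⟨-R, by rw [smul_neg, hR, neg_neg]⟩
  · rintro ⟨R, hR⟩
    exact ⟨-R, by rw [smul_neg, hR]⟩

/-! ## §5 The stub from ONE genus point -/

/-- **One CM-inert Kolyvagin prime with a `4`-indivisible genus point gives the stub's conclusion** (witness
`n = ℓ`: `Squarefree ℓ`, `ℓ.primeFactors = {ℓ}`, and `P(ℓ) ∉ 2E(K[ℓ])` by §4).
[cite: GrossLMS1991, §4 (4.1)] [cite: WZhang2014, Notations (xii)] -/
theorem conclusion_of_genusPoint_not_four_dvd (W : WeierstrassCurve ℚ) [W.IsElliptic]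
    [W.IsGloballyMinimal] [NeZero (W.conductorNorm ℤ)] (hCM : W.HasCM) (hK : IsImaginaryQuadratic K)
    (hodd : Odd (NumberField.discr K)) (h3 : NumberField.discr K ≠ -3)
    (hH : SatisfiesHeegnerHypothesis (W.conductorNorm ℤ) K)
    {Dt : ModularParametrizationData W (W.conductorNorm ℤ)} {β : ℤ} {ι : K →+* ℂ} {ℓ : ℕ}
    (hℓK : Zhang2014.IsKolyvaginPrime (W.conductorNorm ℤ) W K 2 ℓ) (hℓF : CMInert W ℓ)
    (d : KolyvaginHeegnerData Dt β ι ℓ)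
    (hG : ¬ ∃ R : (W.baseChange (ringClassField K ι ℓ)).toAffine.Point, (4 : ℤ) • R =
      ∑ s ∈ d.S, pointGalHom W (ringClassField K ι ℓ) s
        (∑ i ∈ range (ℓ + 1), ((-1 : ℤ) ^ i) • pointGalHom W (ringClassField K ι ℓ) (d.σ ℓ ^ i) d.y)) :
    ∃ (n : ℕ) (d : KolyvaginHeegnerData Dt β ι n), Squarefree n ∧
      (∀ ℓ ∈ n.primeFactors, (Zhang2014.IsKolyvaginPrime (W.conductorNorm ℤ) W K 2 ℓ ∧ CMInert W ℓ)) ∧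
      ¬ ∃ Q : (W.baseChange (ringClassField K ι n)).toAffine.Point, (2 : ℤ) • Q = d.derivedPoint := by
  refine ⟨ℓ, d, hℓK.1.squarefree, fun q hq ↦ ?_, fun h2 ↦ hG
    (exists_four_zsmul_eq_genusPoint_of_two_dvd_derivedPoint W hCM hK hodd h3 hH hℓK hℓF d h2)⟩
  rw [hℓK.1.primeFactors, Finset.mem_singleton] at hq
  subst hq
  exact ⟨hℓK, hℓF⟩

/-- **`stub_positiveDepth` of crux 24648 from ONE genus point per frame.** If on every positive-depth H₂ frame
(the binders of the registered stub, verbatim) some Zhang–Kolyvagin prime `ℓ` at `2` inert in `F` carries a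
Kolyvagin–Heegner datum `d` of conductor `ℓ` whose genus point `Σ_{s ∈ d.S} s(Σ_{i ≤ ℓ} (−1)^i σ_ℓ^i y(ℓ))` is not
`4`-divisible in `E(K[ℓ])`, then the registered signature of `stub_positiveDepth` holds (conclusion = the crux's,
witness `n = ℓ`). The habitat hypotheses `CMInert W 2`, `ρ̄_{W,2}` onto, `r_an = 1`, odd Tamagawa, the Manin
clauses and `y_K` non-torsion are carried, not used. [cite: GrossLMS1991, §3 (3.5), Prop. 3.7 (1), §4 (4.1)] -/
theorem stub_positiveDepth_of_genusPoint
    (hgen : ∀ (W : WeierstrassCurve ℚ) [W.IsElliptic] [W.IsGloballyMinimal] [NeZero (W.conductorNorm ℤ)], W.HasCM → Literature.NumberTheory.EllipticCurves.Rank1Residual.CMInert W 2 → W.HasSurjectiveModNGaloisRep (2 : ℤ) → W.analyticRank = 1 → Odd W.tamagawaProduct → ∀ (K : Type) [Field K] [NumberField K], Literature.NumberTheory.EllipticCurves.IsImaginaryQuadratic K → Odd (NumberField.discr K) → NumberField.discr K ≠ -3 → Literature.NumberTheory.EllipticCurves.SatisfiesHeegnerHypothesis (W.conductorNorm ℤ)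 K → ∀ (Dt : Literature.NumberTheory.EllipticCurves.ModularForms.ModularParametrizationData W (W.conductorNorm ℤ)), (∀ z ∈ Dt.L.lattice, ∃ w ∈ Literature.NumberTheory.EllipticCurves.ModularForms.periodLattice Dt.f, z = (Dt.c : ℂ) * w) → Odd Dt.c → ∀ (β : ℤ) (ι : K →+* ℂ) (d₁ : Literature.NumberTheory.EllipticCurves.KolyvaginHeegnerData Dt β ι 1), ¬ IsOfFinAddOrder d₁.derivedPoint → (∃ Q : (W.baseChange (Literature.NumberTheory.EllipticCurves.ringClassField K ι 1)).toAffine.Point, (2 : ℤ) • Q = d₁.derivedPoint) →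
      ∃ (ℓ : ℕ) (d : Literature.NumberTheory.EllipticCurves.KolyvaginHeegnerData Dt β ι ℓ),
        Literature.NumberTheory.EllipticCurves.Zhang2014.IsKolyvaginPrime (W.conductorNorm ℤ) W K 2 ℓ ∧
        Literature.NumberTheory.EllipticCurves.Rank1Residual.CMInert W ℓ ∧
        ¬ ∃ R : (W.baseChange (Literature.NumberTheory.EllipticCurves.ringClassField K ι ℓ)).toAffine.Point, (4 : ℤ) • R =
          ∑ s ∈ d.S, Literature.NumberTheory.EllipticCurves.pointGalHom W (Literature.NumberTheory.EllipticCurves.ringClassField K ι ℓ) s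
            (∑ i ∈ Finset.range (ℓ + 1), ((-1 : ℤ) ^ i) •
              Literature.NumberTheory.EllipticCurves.pointGalHom W (Literature.NumberTheory.EllipticCurves.ringClassField K ι ℓ) (d.σ ℓ ^ i) d.y)) :
    ∀ (W : WeierstrassCurve ℚ) [W.IsElliptic] [W.IsGloballyMinimal] [NeZero (W.conductorNorm ℤ)], W.HasCM → Literature.NumberTheory.EllipticCurves.Rank1Residual.CMInert W 2 → W.HasSurjectiveModNGaloisRep (2 : ℤ) → W.analyticRank = 1 → Odd W.tamagawaProduct → ∀ (K : Type) [Field K] [NumberField K], Literature.NumberTheory.EllipticCurves.IsImaginaryQuadratic K → Odd (NumberField.discr K) → NumberField.discr K ≠ -3 → Literature.NumberTheory.EllipticCurves.SatisfiesHeegnerHypothesis (W.conductorNorm ℤ) K → ∀ (Dt : Literature.NumberTheory.EllipticCurves.ModularForms.ModularParametrizationData W (W.conductorNorm ℤ)), (∀ z ∈ Dt.L.lattice, ∃ w ∈ Literature.NumberTheory.EllipticCurves.ModularForms.periodLattice Dt.f, z = (Dt.c : ℂ) * w) → Odd Dt.c → ∀ (β : ℤ) (ι : K →+* ℂ) (d₁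 : Literature.NumberTheory.EllipticCurves.KolyvaginHeegnerData Dt β ι 1), ¬ IsOfFinAddOrder d₁.derivedPoint → (∃ Q : (W.baseChange (Literature.NumberTheory.EllipticCurves.ringClassField K ι 1)).toAffine.Point, (2 : ℤ) • Q = d₁.derivedPoint) → ∃ (n : ℕ) (d : Literature.NumberTheory.EllipticCurves.KolyvaginHeegnerData Dt β ι n), Squarefree n ∧ (∀ ℓ ∈ n.primeFactors, (Literature.NumberTheory.EllipticCurves.Zhang2014.IsKolyvaginPrime (W.conductorNorm ℤ) W K 2 ℓ ∧ Literature.NumberTheory.EllipticCurves.Rank1Residual.CMInert W ℓ)) ∧ ¬ ∃ Q : (W.baseChange (Literature.NumberTheory.EllipticCurves.ringClassField K ι n)).toAffine.Point, (2 : ℤ) • Q = d.derivedPoint := by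
  intro W _ _ _ hCM hin hρ hr hT K _ _ hK hodd h3 hH Dt hDt hc β ι d₁ hy h2
  obtain ⟨ℓ, d, hℓK, hℓF, hG⟩ := hgen W hCM hin hρ hr hT K hK hodd h3 hH Dt hDt hc β ι d₁ hy h2
  exact conclusion_of_genusPoint_not_four_dvd W hCM hK hodd h3 hH hℓK hℓF d hG

/-! ## §6 The mod-2 form: `P(ℓ) ≡ −Σ_s s(N_{K[ℓ]/L} y(ℓ))`, NO torsion hypothesis

At a CM-inert Kolyvagin prime the genus point of §4 is twice the HALF-TRACE `A = Σ_{k < (ℓ+1)/2} σ_ℓ^{2k} y(ℓ)`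
(the norm of `y(ℓ)` to the fixed field `L` of `σ_ℓ²`, the quadratic layer of `K[ℓ]/K[1]`): `Tr = A + σA = 0` (§3)
gives `σA = −A`, and `D_ℓ ≡ Σ_{i odd} σ^i = σ·Σ_k (σ²)^k (mod 2)` (GenusKoly `sum_filter_odd_eq_map_sum_sq_pow`,
`heegner_exists_two_zsmul_eq_derivedPoint_iff_oddPart`). Hence, with no hypothesis on torsion,
`P(ℓ) ∈ 2E(K[ℓ]) ⟺ Σ_{s ∈ S} s(A) ∈ 2E(K[ℓ])`: at prime level the open stub is the `2`-indivisibility of the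
trace of the conductor-`ℓ` Heegner point to the genus layer, summed over the transversal `S`. -/

/-- Even indices `≤ ℓ` reindexed: `Σ_{i even ≤ ℓ} σ^i x = Σ_{k < (ℓ+2)/2} (σ²)^k x` (for odd `ℓ`, `(ℓ+2)/2 = (ℓ+1)/2`).
[folklore] -/
private theorem sum_filter_even_eq_sum_sq_pow {G : Type*} [Monoid G] {A : Type*} [AddCommGroup A]
    (ρ : G →* AddMonoid.End A) (σ : G) (ℓ : ℕ) (x : A) :
    ∑ i ∈ (range (ℓ + 1)).filter Even, ρ (σ ^ i) x = ∑ k ∈ range ((ℓ + 2) / 2), ρ ((σ ^ 2) ^ k) x := by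
  have himage : (range (ℓ + 1)).filter Even = (range ((ℓ + 2) / 2)).image (fun k ↦ 2 * k) := by
    ext i
    simp only [Finset.mem_filter, Finset.mem_range, Finset.mem_image]
    constructor
    · rintro ⟨hi, ⟨k, rfl⟩⟩
      exact ⟨k, by omega, by omega⟩
    · rintro ⟨k, hk, rfl⟩
      exact ⟨by omega, ⟨k, by omega⟩⟩
  rw [himage, Finset.sum_image (fun a _ b _ h ↦ by omega)]
  refine Finset.sum_congr rfl fun k _ ↦ ?_
  rw [← pow_mul]

/-- **`σ_ℓ A = −A` for the half-trace `A = Σ_{k < (ℓ+1)/2} σ_ℓ^{2k} y(ℓ)` at a CM-inert Kolyvagin prime** (same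
standing hypotheses as §3): `A + σ_ℓ A = Σ_{i ≤ ℓ} σ_ℓ^i y(ℓ) = 0`. (`A` is the norm of `y(ℓ)` to the fixed field of
`σ_ℓ²`; `σ_ℓ` acts on it by `−1`: a point of the quadratic twist by the genus character of `G_ℓ`.)
[cite: GrossLMS1991, §3 (3.5), Prop. 3.7 (1)] -/
theorem pointGalHom_σ_halfTrace_eq_neg (W : WeierstrassCurve ℚ) [W.IsElliptic] [W.IsGloballyMinimal]
    [NeZero (W.conductorNorm ℤ)] (hCM : W.HasCM) (hK : IsImaginaryQuadratic K)
    (hodd : Odd (NumberField.discr K)) (h3 : NumberField.discr K ≠ -3)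
    (hH : SatisfiesHeegnerHypothesis (W.conductorNorm ℤ) K)
    {Dt : ModularParametrizationData W (W.conductorNorm ℤ)} {β : ℤ} {ι : K →+* ℂ} {ℓ : ℕ}
    (hℓK : Zhang2014.IsKolyvaginPrime (W.conductorNorm ℤ) W K 2 ℓ) (hℓF : CMInert W ℓ)
    (d : KolyvaginHeegnerData Dt β ι ℓ) :
    pointGalHom W (ringClassField K ι ℓ) (d.σ ℓ)
        (∑ k ∈ range ((ℓ + 1) / 2), pointGalHom W (ringClassField K ι ℓ) ((d.σ ℓ ^ 2) ^ k) d.y) =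
      -∑ k ∈ range ((ℓ + 1) / 2), pointGalHom W (ringClassField K ι ℓ) ((d.σ ℓ ^ 2) ^ k) d.y := by
  have hℓodd : Odd ℓ := hℓK.1.odd_of_ne_two hℓK.2.2.2.1
  have h2 : (ℓ + 2) / 2 = (ℓ + 1) / 2 := by obtain ⟨r, hr⟩ := hℓodd; omega
  have htr := sum_range_pointGalHom_σ_pow_y_eq_zero W hCM hK hodd h3 hH hℓK hℓF d
  rw [← Finset.sum_filter_add_sum_filter_not (range (ℓ + 1)) Even] at htr
  simp only [Nat.not_even_iff_odd] at htr
  rw [sum_filter_even_eq_sum_sq_pow, h2, GenusKoly.sum_filter_odd_eq_map_sum_sq_pow] at htr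
  exact eq_neg_of_add_eq_zero_right htr

/-- **The mod-`2` form of the stub at prime level, NO torsion hypothesis**: at a Zhang–Kolyvagin prime `ℓ` at `2`
inert in `F` (standing hypotheses of §3), for any datum `d` of conductor `ℓ`,
**`P(ℓ) ∈ 2E(K[ℓ]) ⟺ Σ_{s ∈ S} s(Σ_{k < (ℓ+1)/2} σ_ℓ^{2k} y(ℓ)) ∈ 2E(K[ℓ])`** — `P(ℓ) ≡ Σ_s s(σ_ℓ A) = −Σ_s s(A)`
modulo `2E(K[ℓ])` (GenusKoly odd-part dictionary + `σ_ℓ A = −A`). [cite: GrossLMS1991, §3 (3.5), §4 (4.1)] -/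
theorem two_dvd_derivedPoint_iff_two_dvd_halfTrace (W : WeierstrassCurve ℚ) [W.IsElliptic]
    [W.IsGloballyMinimal] [NeZero (W.conductorNorm ℤ)] (hCM : W.HasCM) (hK : IsImaginaryQuadratic K)
    (hodd : Odd (NumberField.discr K)) (h3 : NumberField.discr K ≠ -3)
    (hH : SatisfiesHeegnerHypothesis (W.conductorNorm ℤ) K)
    {Dt : ModularParametrizationData W (W.conductorNorm ℤ)} {β : ℤ} {ι : K →+* ℂ} {ℓ : ℕ}
    (hℓK : Zhang2014.IsKolyvaginPrime (W.conductorNorm ℤ) W K 2 ℓ) (hℓF : CMInert W ℓ)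
    (d : KolyvaginHeegnerData Dt β ι ℓ) :
    (∃ Q : (W.baseChange (ringClassField K ι ℓ)).toAffine.Point, (2 : ℤ) • Q = d.derivedPoint) ↔
      ∃ Q : (W.baseChange (ringClassField K ι ℓ)).toAffine.Point, (2 : ℤ) • Q =
        ∑ s ∈ d.S, pointGalHom W (ringClassField K ι ℓ) s
          (∑ k ∈ range ((ℓ + 1) / 2), pointGalHom W (ringClassField K ι ℓ) ((d.σ ℓ ^ 2) ^ k) d.y) := by
  rw [GenusKoly.heegner_exists_two_zsmul_eq_derivedPoint_iff_oddPart d, Nat.primeFactorsList_prime hℓK.1,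
    List.foldr_cons, List.foldr_nil, GenusKoly.sum_filter_odd_eq_map_sum_sq_pow,
    pointGalHom_σ_halfTrace_eq_neg W hCM hK hodd h3 hH hℓK hℓF d]
  simp only [map_neg, Finset.sum_neg_distrib]
  constructor
  · rintro ⟨Q, hQ⟩
    exact ⟨-Q, by rw [smul_neg, hQ, neg_neg]⟩
  · rintro ⟨Q, hQ⟩
    exact ⟨-Q, by rw [smul_neg, hQ]⟩

end Summit.BirchSwinnertonDyer.BirchSwinnertonDyer.Theorems.CMKolyvaginConjecturePositiveDepth

end
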